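import Mathlib
import Literature.NumberTheory.Transcendental.OkadaCriterionFibresProofs
import Literature.AlgebraicGeometry.Frobenioids.LogPrimesLinearIndependent
import HarnessLib

/-!
# Okada's criterion, prime form II: `Σ_{m∈M(q)} (log m/m) S(m) = Σ_{p∣q} log p · Σ_r f(r) ε(r,p)` (Chatterjee–Murty Thm 4)

Topic `Literature/NumberTheory/Transcendental`; namespace `Literature.NumberTheory.Transcendental.OkadaCriterion`.
THEOREMS only (no definition, no named fact, no `sorry`); cell pub-zeta5, P1 g58. Sequel of
`OkadaCriterionFibresProofs.lean`; completes OKADA'S CRITERION [Okada1982] in the printed Saradha–Tijdeman form of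
T. Chatterjee, M. Ram Murty, *Non-vanishing of Dirichlet series with periodic coefficients*, JNT **145** (2014)
[ChatterjeeMurty2014], **Proposition 2**: «`L(1,f) = 0` if and only if `Σ_{m∈M(q)} f(am)/m = 0` for every `a` with
`1 ≤ a < q`, `(a,q) = 1`, and `Σ_{(r,q)>1} f(r)ε(r,p) = 0` for every prime divisor `p` of `q`», where
«`ε(r,p) = v_p(r)` if `v_p(r) < v_p(q)`, `v_p(q) + 1/(p−1)` otherwise» — via **Theorem 4**: «`Σ_{b∈M(q)}
((f_b,χ₀)/b) log b = 0` if and only if `Σ_{(r,q)>1} f(r)ε(r,p) = 0` for every prime divisor `p` of `q`» (READ, §5;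
also R. Tijdeman 2002 [Tijdeman2002], Appendix, Theorem 8, equations (5.5), READ).

## What is proved (`N ≥ 1`, `M(N)` = `Nat.factoredNumbers N.primeFactors`; `ε(r,p)` is written out as
`v_p(gcd(r,N)) + [p ∤ N/gcd(r,N)]·1/(p−1)` with `r` read in `[0,N)`, `gcd(0,N) = N`)

* **`tsum_log_mul_sum_units_div_eq_sum_primeFactors`** — for ANY `f : ℤ/N → ℂ`:
  `Σ_{m∈M(N)} (log m/m) Σ_{j unit} f(mj) = Σ_{p∣N} log p · Σ_{r∈ℤ/N} f(r) ε(r,p)` (the identity behind Theorem 4: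
  fibre decomposition, `λ_d = μ_d(log d + Σ_{p∈P(d)} log p/(p−1))`, `μ_d S(d) = Σ_{gcd(r,N)=d} f(r)`,
  `log d = Σ_p v_p(d) log p`);
* **`tsum_log_mul_sum_units_div_eq_zero_iff`** = THEOREM 4 for rational `f` (the `log p` are `ℚ`-linearly
  independent: the tree's `Frobenioids.linearIndependent_rat_log_primes`);
* **`LFunction_one_eq_zero_iff_prime_form`** = OKADA'S CRITERION / Proposition 2 with the second condition as the
  `ω(q)` equations `Σ_r f(r)ε(r,p) = 0`, `p ∣ N`;
* `epsilon_eq_zero_of_isUnit`, `epsilon_eq_of_lt`, `epsilon_eq_of_le` — the written-out `ε` agrees with the printed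
  cases (`0` on units, `v_p(r)` if `v_p(r) < v_p(N)`, `v_p(N) + 1/(p−1)` otherwise / at `r = 0`).

Faithfulness: the first condition stays in its printed absolutely-convergent form `Σ_{m∈M(q)} f(am)/m = 0`
(Tijdeman's finite rewriting (5.4) is not typed); the `ε`-sums run over all `r` (units contribute `0`).
HONEST FRAMING: a printed 1982/2014 criterion made a kernel theorem on the tree's proved Baker theorem; nothing here
concerns `ζ(5)`; Erdős's conjecture for composite `q ≡ 1 (mod 4)` with `2φ(q)+1 ≤ q` stays OPEN.
-/

noncomputable section

open Complex Finset Filter Topology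
open Literature.NumberTheory.LFunctions.ChatterjeeMurty2014
open Literature.AlgebraicGeometry.Frobenioids (linearIndependent_rat_log_primes)

namespace Literature.NumberTheory.Transcendental

namespace OkadaCriterion

variable {N : ℕ} [NeZero N]

/-! ### Chatterjee–Murty's Theorem 4: the logarithmic Okada sum in the `ε(r,p)` form -/

/-- `log d = Σ_{p∣N} v_p(d) log p` for `d ∣ N`. [folklore] -/
private theorem log_eq_sum_primeFactors {d : ℕ} (hd : d ∣ N) :
    Complex.log (d : ℂ) = ∑ p ∈ N.primeFactors, (d.factorization p : ℂ) * Complex.log (p : ℂ) := by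
  have hN : N ≠ 0 := NeZero.ne N
  have hreal : Real.log d = ∑ p ∈ N.primeFactors, (d.factorization p : ℝ) * Real.log p := by
    rw [Real.log_nat_eq_sum_factorization d, Finsupp.sum]
    refine Finset.sum_subset ?_ fun p _ hp => ?_
    · rw [Nat.support_factorization]
      exact Nat.primeFactors_mono hd hN
    · rw [Finsupp.notMem_support_iff.mp hp, Nat.cast_zero, zero_mul]
  rw [← Complex.natCast_log, hreal]
  push_cast
  exact Finset.sum_congr rfl fun p _ => rfl

/-- **Chatterjee–Murty 2014, Theorem 4 (the identity behind it).** For ANY `f : ℤ/N → ℂ`, the logarithmic Okada sum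
splits prime by prime:
`Σ_{m∈M(N)} (log m/m) Σ_{j unit} f(mj) = Σ_{p∣N} log p · Σ_{r∈ℤ/N} f(r) ε(r,p)`, with
`ε(r,p) = v_p(gcd(r,N)) + [p ∤ N/gcd(r,N)]/(p−1)` (`= v_p(r)` if `v_p(r) < v_p(N)`, `= v_p(N) + 1/(p−1)` otherwise,
`= 0` on the units; `r` read in `[0, N)`, `gcd(0,N) = N`). Route: fibre decomposition, `λ_d = μ_d(log d +
Σ_{p∈P(d)} log p/(p−1))`, `μ_d S(d) = Σ_{gcd(r,N)=d} f(r)`, and `log d = Σ_p v_p(d) log p` — the source instead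
counts solutions of congruences (Lemma 1). [cite: ChatterjeeMurty2014, Theorem 4 and Lemma 1] [cite: Tijdeman2002, Appendix, Theorem 8 (5.5)] -/
theorem tsum_log_mul_sum_units_div_eq_sum_primeFactors (f : ZMod N → ℂ) :
    ∑' m : Nat.factoredNumbers N.primeFactors, Complex.log ((m : ℕ) : ℂ) *
        (∑ j : ZMod N, (1 : DirichletCharacter ℂ N) j * f ((m : ℕ) * j)) / ((m : ℕ) : ℂ) =
      ∑ p ∈ N.primeFactors, Complex.log (p : ℂ) * ∑ r : ZMod N, f r *
        (((Nat.gcd r.val N).factorization p : ℂ) +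
          if ¬ p ∣ N / Nat.gcd r.val N then 1 / ((p : ℂ) - 1) else 0) := by
  classical
  have hN : N ≠ 0 := NeZero.ne N
  have hP : ∀ p ∈ N.primeFactors, p.Prime := fun p hp => Nat.prime_of_mem_primeFactors hp
  -- Step 1: fibre decomposition with `w(m) = log m / m`
  have hw : Summable fun m : Nat.factoredNumbers N.primeFactors =>
      ‖(fun n : ℕ => Complex.log (n : ℂ) / (n : ℂ)) m‖ :=
    (summable_factoredNumbers_log_div' N.primeFactors hP).norm
  have h1 : ∑' m : Nat.factoredNumbers N.primeFactors, Complex.log ((m : ℕ) : ℂ) *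
      (∑ j : ZMod N, (1 : DirichletCharacter ℂ N) j * f ((m : ℕ) * j)) / ((m : ℕ) : ℂ) =
      ∑' m : Nat.factoredNumbers N.primeFactors, (fun n : ℕ => Complex.log (n : ℂ) / (n : ℂ)) m *
        ∑ j : ZMod N, (1 : DirichletCharacter ℂ N) j * f ((m : ℕ) * j) :=
    tsum_congr fun m => by beta_reduce; rw [mul_div_right_comm]
  rw [h1, tsum_mul_sum_units_eq_sum_divisors f (fun n : ℕ => Complex.log (n : ℂ) / (n : ℂ)) hw]
  -- Steps 2–3: `S(d) λ_d = F_d · (log d + Σ_{p∈P(d)} log p/(p−1))`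
  have h2 : ∀ d ∈ N.divisors, (∑ j : ZMod N, (1 : DirichletCharacter ℂ N) j * f ((d : ℕ) * j)) *
      (∑' m : Nat.factoredNumbers N.primeFactors,
        (if Nat.gcd (m : ℕ) N = d then Complex.log ((m : ℕ) : ℂ) / ((m : ℕ) : ℂ) else 0)) =
      (∑ r ∈ Finset.univ.filter (fun r : ZMod N => Nat.gcd r.val N = d), f r) *
        (Complex.log d + ∑ p ∈ N.primeFactors.filter (fun p => ¬ p ∣ N / d), Complex.log p / ((p : ℂ) - 1)) := by
    intro d hd
    have hdN : d ∣ N := Nat.dvd_of_mem_divisors hd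
    rw [tsum_indicator_gcd_log_div_eq (N := N) hdN, ← tsum_indicator_gcd_inv_mul_sum_units_eq hdN f]
    ring
  rw [Finset.sum_congr rfl h2]
  -- Step 4: `Σ_d Σ_{gcd(r)=d} = Σ_r`
  have h4 : ∑ d ∈ N.divisors, (∑ r ∈ Finset.univ.filter (fun r : ZMod N => Nat.gcd r.val N = d), f r) *
      (Complex.log d + ∑ p ∈ N.primeFactors.filter (fun p => ¬ p ∣ N / d), Complex.log p / ((p : ℂ) - 1)) =
      ∑ r : ZMod N, f r * (Complex.log (Nat.gcd r.val N : ℕ) +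
        ∑ p ∈ N.primeFactors.filter (fun p => ¬ p ∣ N / Nat.gcd r.val N), Complex.log p / ((p : ℂ) - 1)) := by
    simp_rw [Finset.sum_mul, Finset.sum_filter]
    rw [Finset.sum_comm]
    refine Finset.sum_congr rfl fun r _ => ?_
    have hmem : Nat.gcd r.val N ∈ N.divisors := Nat.mem_divisors.mpr ⟨Nat.gcd_dvd_right _ _, hN⟩
    rw [Finset.sum_eq_single_of_mem (Nat.gcd r.val N) hmem (fun d _ hne => if_neg (Ne.symm hne)), if_pos rfl]
  rw [h4]
  -- Step 5: expand `log d` and the `P(d)`-sum over all `p ∣ N`, then swap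
  have h5 : ∀ r : ZMod N, Complex.log (Nat.gcd r.val N : ℕ) +
      ∑ p ∈ N.primeFactors.filter (fun p => ¬ p ∣ N / Nat.gcd r.val N), Complex.log p / ((p : ℂ) - 1) =
      ∑ p ∈ N.primeFactors, Complex.log (p : ℂ) *
        (((Nat.gcd r.val N).factorization p : ℂ) +
          if ¬ p ∣ N / Nat.gcd r.val N then 1 / ((p : ℂ) - 1) else 0) := by
    intro r
    rw [log_eq_sum_primeFactors (Nat.gcd_dvd_right r.val N), Finset.sum_filter, ← Finset.sum_add_distrib]
    refine Finset.sum_congr rfl fun p _ => ?_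
    split_ifs <;> ring
  simp_rw [h5, Finset.mul_sum]
  rw [Finset.sum_comm]
  exact Finset.sum_congr rfl fun p _ => Finset.sum_congr rfl fun r _ => by ring


/-! ### The criterion with `ω(q)` rational equations -/

/-- A rational relation `Σ_{p∈S} c_p log p = 0` among logarithms of distinct primes is trivial (unique factorisation;
the tree's `Frobenioids.linearIndependent_rat_log_primes`). [folklore] -/
private theorem eq_zero_of_sum_mul_log_eq_zero (S : Finset ℕ) (hS : ∀ p ∈ S, p.Prime) (c : ℕ → ℚ)
    (h : ∑ p ∈ S, (c p : ℝ) * Real.log p = 0) : ∀ p ∈ S, c p = 0 := by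
  classical
  intro p hp
  have hli := linearIndependent_iff'.mp linearIndependent_rat_log_primes
    (S.subtype Nat.Prime) (fun q => c q.1)
  have hsum : ∑ q ∈ S.subtype Nat.Prime, (fun q : Nat.Primes => c q.1) q • Real.log ((q : ℕ) : ℝ) = 0 := by
    have e : ∑ q ∈ S.subtype Nat.Prime, (fun q : Nat.Primes => c q.1) q • Real.log ((q : ℕ) : ℝ) =
        ∑ x ∈ S.filter Nat.Prime, (c x : ℝ) * Real.log x := by
      rw [← Finset.sum_subtype_eq_sum_filter]
      exact Finset.sum_congr rfl fun q _ => by rw [Rat.smul_def]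
    rw [e, Finset.filter_true_of_mem hS, h]
  exact hli hsum ⟨p, hS p hp⟩ (Finset.mem_subtype.2 hp)

/-- **Chatterjee–Murty 2014, Theorem 4**: «`Σ_{b∈M(q)} ((f_b,χ₀)/b) log b = 0` if and only if
`Σ_{(r,q)>1} f(r) ε(r,p) = 0` for every prime divisor `p` of `q`, where `ε(r,p) = v_p(r)` if `v_p(r) < v_p(q)`,
`v_p(q) + 1/(p−1)` otherwise» — for rational-valued `f` (the `ω(q)` equations (5.5) of Okada / Tijdeman's
Theorem 8; the coefficient of each `log p` is rational and the `log p` are `ℚ`-linearly independent). The sum here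
runs over all `r ∈ ℤ/N`; the units contribute `ε = 0` (`epsilon_eq_zero_of_isUnit`).
[cite: ChatterjeeMurty2014, Theorem 4] [cite: Tijdeman2002, Appendix, Theorem 8 (5.5)] [cite: Okada1982, Theorem] -/
theorem tsum_log_mul_sum_units_div_eq_zero_iff (f : ZMod N → ℚ) :
    ∑' m : Nat.factoredNumbers N.primeFactors, Complex.log ((m : ℕ) : ℂ) *
        (∑ j : ZMod N, (1 : DirichletCharacter ℂ N) j * ((f ((m : ℕ) * j) : ℚ) : ℂ)) / ((m : ℕ) : ℂ) = 0 ↔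
      ∀ p ∈ N.primeFactors, ∑ r : ZMod N, f r *
        (((Nat.gcd r.val N).factorization p : ℚ) +
          if ¬ p ∣ N / Nat.gcd r.val N then 1 / ((p : ℚ) - 1) else 0) = 0 := by
  classical
  have hP : ∀ p ∈ N.primeFactors, p.Prime := fun p hp => Nat.prime_of_mem_primeFactors hp
  rw [tsum_log_mul_sum_units_div_eq_sum_primeFactors (fun j => ((f j : ℚ) : ℂ))]
  set c : ℕ → ℚ := fun p => ∑ r : ZMod N, f r *
    (((Nat.gcd r.val N).factorization p : ℚ) + if ¬ p ∣ N / Nat.gcd r.val N then 1 / ((p : ℚ) - 1) else 0) with hc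
  have hcast : ∀ p : ℕ, ∑ r : ZMod N, ((f r : ℚ) : ℂ) *
      (((Nat.gcd r.val N).factorization p : ℂ) + if ¬ p ∣ N / Nat.gcd r.val N then 1 / ((p : ℂ) - 1) else 0) =
      ((c p : ℚ) : ℂ) := by
    intro p
    simp only [hc]
    push_cast
    refine Finset.sum_congr rfl fun r _ => ?_
    split_ifs <;> push_cast <;> ring
  simp_rw [hcast]
  have hreal : ∑ p ∈ N.primeFactors, Complex.log (p : ℂ) * ((c p : ℚ) : ℂ) =
      ((∑ p ∈ N.primeFactors, (c p : ℝ) * Real.log p : ℝ) : ℂ) := by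
    push_cast
    refine Finset.sum_congr rfl fun p _ => ?_
    rw [← Complex.natCast_log]
    push_cast
    ring
  rw [hreal]
  constructor
  · intro h p hp
    exact eq_zero_of_sum_mul_log_eq_zero N.primeFactors hP c (by exact_mod_cast h) p hp
  · intro h
    have hz : ∀ p ∈ N.primeFactors, (c p : ℝ) * Real.log p = 0 := fun p hp => by
      have : c p = 0 := h p hp
      rw [this, Rat.cast_zero, zero_mul]
    rw [Finset.sum_eq_zero hz]
    push_cast
    rfl

/-- **OKADA'S CRITERION in the printed form** (Okada 1982 / Saradha–Tijdeman; Chatterjee–Murty 2014, Prop. 2 +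
Thm 3 + Thm 4): for `f : ℤ/N → ℚ` with `Σ_j f(j) = 0`,
`L(1,f) = 0 ⟺ [∀ units a: Σ_{m∈M(N)} f(am)/m = 0] ∧ [∀ p ∣ N: Σ_{r∈ℤ/N} f(r) ε(r,p) = 0]`
(`φ(q) + ω(q)` homogeneous linear equations with rational coefficients — the first family still in its absolutely
convergent form, cf. Tijdeman's finite form (5.4), not typed). [cite: ChatterjeeMurty2014, Proposition 2 and Theorems 3–4] [cite: Okada1982, Theorem] [cite: Tijdeman2002, Appendix, Theorem 8] -/
theorem LFunction_one_eq_zero_iff_prime_form (f : ZMod N → ℚ) (hf : ∑ j : ZMod N, ((f j : ℚ) : ℂ) = 0) :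
    ZMod.LFunction (fun j => ((f j : ℚ) : ℂ)) 1 = 0 ↔
      (∀ a : ZMod N, IsUnit a →
        ∑' m : Nat.factoredNumbers N.primeFactors, ((f ((m : ℕ) * a) : ℚ) : ℂ) / ((m : ℕ) : ℂ) = 0) ∧
      ∀ p ∈ N.primeFactors, ∑ r : ZMod N, f r *
        (((Nat.gcd r.val N).factorization p : ℚ) +
          if ¬ p ∣ N / Nat.gcd r.val N then 1 / ((p : ℚ) - 1) else 0) = 0 :=
  (LFunction_one_eq_zero_iff f hf).trans (and_congr Iff.rfl (tsum_log_mul_sum_units_div_eq_zero_iff f))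

/-! ### The printed case description of `ε(r,p)` -/

omit [NeZero N] in
/-- On the units, `ε(r,p) = 0` (so the `ε`-sums run over `(r,q) > 1` as printed). [cite: ChatterjeeMurty2014, Theorem 4] -/
theorem epsilon_eq_zero_of_isUnit {r : ZMod N} (hr : IsUnit r) {p : ℕ} (hp : p ∈ N.primeFactors) :
    ((Nat.gcd r.val N).factorization p : ℚ) + (if ¬ p ∣ N / Nat.gcd r.val N then 1 / ((p : ℚ) - 1) else 0) = 0 := by
  obtain ⟨u, rfl⟩ := hr
  have hg : Nat.gcd (u : ZMod N).val N = 1 := Nat.Coprime.gcd_eq_one (ZMod.val_coe_unit_coprime u)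
  rw [hg, Nat.factorization_one, Nat.div_one]
  simp [Nat.dvd_of_mem_primeFactors hp]

/-- `ε(r,p) = v_p(r)` when `v_p(r) < v_p(q)` (`r ≠ 0` read in `[1, q)`). [cite: ChatterjeeMurty2014, Theorem 4] -/
theorem epsilon_eq_of_lt {r : ZMod N} (hr : r ≠ 0) {p : ℕ} (hp : p ∈ N.primeFactors)
    (hlt : r.val.factorization p < N.factorization p) :
    ((Nat.gcd r.val N).factorization p : ℚ) + (if ¬ p ∣ N / Nat.gcd r.val N then 1 / ((p : ℚ) - 1) else 0) =
      r.val.factorization p := by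
  have hN : N ≠ 0 := NeZero.ne N
  have hr0 : r.val ≠ 0 := fun h => hr ((ZMod.val_eq_zero r).mp h)
  have hpp : p.Prime := Nat.prime_of_mem_primeFactors hp
  have hgcd : (Nat.gcd r.val N).factorization p = r.val.factorization p := by
    rw [Nat.factorization_gcd hr0 hN, Finsupp.inf_apply]
    exact min_eq_left hlt.le
  have hdiv : p ∣ N / Nat.gcd r.val N := by
    have hq0 : N / Nat.gcd r.val N ≠ 0 :=
      (Nat.div_pos (Nat.le_of_dvd (Nat.pos_of_ne_zero hN) (Nat.gcd_dvd_right _ _))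
        (Nat.gcd_pos_of_pos_right _ (Nat.pos_of_ne_zero hN))).ne'
    rw [hpp.dvd_iff_one_le_factorization hq0, Nat.factorization_div (Nat.gcd_dvd_right _ _),
      Finsupp.tsub_apply, hgcd]
    omega
  rw [hgcd, if_neg (not_not.mpr hdiv), add_zero]

/-- `ε(r,p) = v_p(q) + 1/(p−1)` when `v_p(r) ≥ v_p(q)` or `r = 0` (i.e. `r = q` in `[1, q]`).
[cite: ChatterjeeMurty2014, Theorem 4] -/
theorem epsilon_eq_of_le {r : ZMod N} {p : ℕ} (hp : p ∈ N.primeFactors)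
    (hle : r = 0 ∨ N.factorization p ≤ r.val.factorization p) :
    ((Nat.gcd r.val N).factorization p : ℚ) + (if ¬ p ∣ N / Nat.gcd r.val N then 1 / ((p : ℚ) - 1) else 0) =
      N.factorization p + 1 / ((p : ℚ) - 1) := by
  have hN : N ≠ 0 := NeZero.ne N
  have hpp : p.Prime := Nat.prime_of_mem_primeFactors hp
  by_cases hr : r = 0
  · subst hr
    rw [ZMod.val_zero, Nat.gcd_zero_left, Nat.div_self (Nat.pos_of_ne_zero hN)]
    simp [hpp.ne_one, Nat.dvd_one]
  · have hle' : N.factorization p ≤ r.val.factorization p := hle.resolve_left hr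
    have hr0 : r.val ≠ 0 := fun h => hr ((ZMod.val_eq_zero r).mp h)
    have hgcd : (Nat.gcd r.val N).factorization p = N.factorization p := by
      rw [Nat.factorization_gcd hr0 hN, Finsupp.inf_apply]
      exact min_eq_right hle'
    have hndiv : ¬ p ∣ N / Nat.gcd r.val N := by
      have hq0 : N / Nat.gcd r.val N ≠ 0 :=
        (Nat.div_pos (Nat.le_of_dvd (Nat.pos_of_ne_zero hN) (Nat.gcd_dvd_right _ _))
          (Nat.gcd_pos_of_pos_right _ (Nat.pos_of_ne_zero hN))).ne'
      rw [hpp.dvd_iff_one_le_factorization hq0, Nat.factorization_div (Nat.gcd_dvd_right _ _),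
        Finsupp.tsub_apply, hgcd]
      omega
    rw [hgcd, if_pos hndiv]

end OkadaCriterion

end Literature.NumberTheory.Transcendental

end
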